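import Summits.MatrixMultiplication.MatrixMultiplication.Theorems.ObstructionDescentTowerCells

set_option linter.dupNamespace false

/-!
# Point levels are read on the corner block; hypothesis (U) is format-intrinsic (decomp-mm · lens 3 · gen 17)

Route `route-MatrixMultiplication-ObstructionDescent` (sub-problem `MatrixMultiplication`, `ω(ℂ) = 2`), rev 7 `3f9f51b758cc`;
support for the aside **`InvariantSaturation`** (item `stmt-MatrixMultiplication-32282`).  Continues the LANDED
`ObstructionDescentEmptyLevelFormat` (descent of corner-type weight vectors `exists_eq_liftPoly_of_mem_hwvSpace`, format
independence of EMPTY levels `mem_emptyLevels_iff_self`), `ObstructionDescentLevelMonoid` (`liftPoly`, `cornerOf`,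
`pointLevels_subset_pointLevels_pad`) and `ObstructionDescentTowerCells` (`passLevels_self_eq_pointLevels`,
`tower_wall_of_unitLevels`, `invariantSaturation_three_of_wallCells`); restates nothing.

* **§1 Cross-format corner law (`pointLevels_eq_pointLevels_cornerOf`).**  For `N ≤ m` and ANY tensor `x` of format `d + m`, the
  levels of `x` with respect to the corner size `N` are the levels of its top corner block `cornerOf d x` (a tensor of format
  `m`): `E'_N(x) = E'_N(x|corner)` ACROSS formats (the landed `pointLevels_cornerProj` is the in-format statement).  Hence POINT
  LEVELS ARE FORMAT-INDEPENDENT under zero-padding (`pointLevels_padTensor_natAdd_eq`, both inclusions; the landed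
  `pointLevels_subset_pointLevels_pad` was one of them) — the companion of the landed format independence of empty levels.
* **§2 (U) is intrinsic (`pointLevels_padUnitLast_eq_self`, `pointLevels_padUnitLast_eq_passLevels_self`).**  The levels of the
  padded unit tensor `⟨N⟩ ∈ ℂ^m ⊗ ℂ^m ⊗ ℂ^m` (`padUnitLast m N`, `N ≤ m`) are the levels of `⟨N⟩ ∈ ℂ^N ⊗ ℂ^N ⊗ ℂ^N` itself, and these
  are the PASSING LEVELS OF THE FIRST CELL `(N, N)` of the tower: `E'_N(⟨N⟩_pad) = E'(⟨N⟩) = passLevels N N`.  So hypothesis (U)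
  of the landed cell theorems (`tower_of_unitLevels`, `tower_wall_of_unitLevels`, …), stated there at the ambient format `m`,
  does not depend on `m` (`pointLevels_padUnitLast_eq_of_le`).
* **§3 The `3 < τ < 4` slices from two statements about ONE format (`invariantSaturation_three_of_unitLevels_self`, tree level).**
  For `3 < τ < 4` the item follows from, eventually in `n` and with `N = n²` — (U_N) every even `e ≥ n` is a level of the unit
  tensor `⟨N⟩ ∈ ℂ^N⊗ℂ^N⊗ℂ^N` (some weight vector of type `((e^N))³` is non-zero at `⟨N⟩`; a FINITE check per `n` over the primitive
  window `n ≤ e ≤ 2n`, `invariantSaturation_three_of_primLevels_self`), and (Ko_N) the odd one of `n, n+1` is a non-empty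
  level of the format `N` (Kronecker positivity `g((o^N),(o^N),(o^N)) > 0`) — no ambient format `m`, no (K0), no (P).
SCOPE (honest): bookkeeping-plus — the mathematical input is the landed descent lemma; the value is that every hypothesis of the
`3 < τ < 4` half of `InvariantSaturation` is now a statement about the single space `ℂ^N⊗ℂ^N⊗ℂ^N`, `N = n²`, and its unit
tensor.  (U_N) is BI17 Problem 5.23 in level form and (Ko_N) an instance of BI17 Problem 5.19 / Thm 5.9(3); neither is proved
here, and nothing here proves `ω = 2`.
[cite: BurgisserIkenmeyer2011, §2 (zero-padding of formats), Lemma 3.2, §3.1; BurgisserIkenmeyer2017, §5 (5.2), Thm 5.3,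
Thm 5.9, Problems 5.19 and 5.23]
-/

noncomputable section

open scoped BigOperators
open Finset

namespace Summit.MatrixMultiplication.MatrixMultiplication.Theorems.ObstructionCalculus

open Literature.Computability.AlgebraicComplexity (unitTensor unitTensor_apply)

section PointLevelFormat

variable {m : ℕ}

/-! ### §1 · Levels of a point are the levels of its corner block, across formats -/

/-- **Cross-format corner law.**  For `N ≤ m` and any `x` of format `d + m`: `E'_N(x) = E'_N(cornerOf d x)`, the right-hand
side read at format `m` (descent `F = liftPoly d f` of corner-type weight vectors + `F(x) = f(x|corner)`). [this node] -/
theorem pointLevels_eq_pointLevels_cornerOf {N : ℕ} (hN : N ≤ m) (d : ℕ) (x : Tensor ℂ (d + m)) :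
    pointLevels N x = pointLevels N (cornerOf d x) := by
  ext k
  constructor
  · rintro ⟨F, hF, hne⟩
    obtain ⟨f, hf, rfl⟩ := exists_eq_liftPoly_of_mem_hwvSpace hN hF
    exact ⟨f, hf, by rwa [evalT_liftPoly] at hne⟩
  · rintro ⟨f, hf, hne⟩
    refine ⟨liftPoly d f, ?_, by rwa [evalT_liftPoly]⟩
    rw [← liftType_rectType hN]
    exact liftPoly_mem_hwvSpace hf

/-- **Point levels are format-independent:** `E'_N(pad p) = E'_N(p)` for the zero-padding of `p` (format `m`, `N ≤ m`) into the
top corner of the format `d + m` (the landed `pointLevels_subset_pointLevels_pad` is `⊇`). [this node] -/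
theorem pointLevels_padTensor_natAdd_eq {N : ℕ} (hN : N ≤ m) (d : ℕ) (p : Tensor ℂ m) :
    pointLevels N (padTensor (Fin.natAdd d) p) = pointLevels N p := by
  rw [pointLevels_eq_pointLevels_cornerOf hN d, cornerOf_padTensor]

/-! ### §2 · The levels of `⟨N⟩` do not depend on the ambient format: (U) is intrinsic -/

/-- The top corner of the padded unit tensor `⟨N⟩ ∈ ℂ^{d+N} ⊗ ℂ^{d+N} ⊗ ℂ^{d+N}` is `⟨N⟩`. [bookkeeping] -/
theorem cornerOf_padUnitLast (d N : ℕ) : cornerOf d (padUnitLast (d + N) N) = unitTensor ℂ N := by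
  funext a b c
  show padUnitLast (d + N) N (Fin.natAdd d a) (Fin.natAdd d b) (Fin.natAdd d c) = unitTensor ℂ N a b c
  rw [padUnitLast_apply, unitTensor_apply]
  have h : d + N ≤ (Fin.natAdd d a : ℕ) + N := by simp only [Fin.val_natAdd]; omega
  simp only [Fin.natAdd_inj, h, and_true]

/-- **(U) is intrinsic:** the levels of the padded unit tensor `⟨N⟩_pad = padUnitLast m N` (`N ≤ m`) are the levels of the unit
tensor `⟨N⟩ ∈ ℂ^N ⊗ ℂ^N ⊗ ℂ^N` at its own format. [this node] -/
theorem pointLevels_padUnitLast_eq_self {N : ℕ} (hN : N ≤ m) :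
    pointLevels N (padUnitLast m N) = pointLevels N (unitTensor ℂ N) := by
  obtain ⟨d, rfl⟩ := Nat.exists_eq_add_of_le' hN
  rw [pointLevels_eq_pointLevels_cornerOf le_rfl d, cornerOf_padUnitLast]

/-- **… and they are the passing levels of the FIRST CELL `(N, N)`:** `E'_N(⟨N⟩_pad) = passLevels N N` (`N ≤ m`). [this node] -/
theorem pointLevels_padUnitLast_eq_passLevels_self {N : ℕ} (hN : N ≤ m) :
    pointLevels N (padUnitLast m N) = passLevels N N := by
  rw [pointLevels_padUnitLast_eq_self hN, passLevels_self_eq_pointLevels]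

/-- Hence the set of levels of `⟨N⟩_pad` is the same at every ambient format `m, m' ≥ N`. [this node] -/
theorem pointLevels_padUnitLast_eq_of_le {N m' : ℕ} (hN : N ≤ m) (hN' : N ≤ m') :
    pointLevels N (padUnitLast m N) = pointLevels N (padUnitLast m' N) := by
  rw [pointLevels_padUnitLast_eq_self hN, pointLevels_padUnitLast_eq_self hN']

/-- A level of `⟨N⟩` passes at every cell `(m, N)`, `N ≤ m` (first-cell passing + monotonicity, or directly). [this node] -/
theorem pointLevels_unitTensor_subset_passLevels {N : ℕ} (hN : N ≤ m) :
    pointLevels N (unitTensor ℂ N) ⊆ passLevels m N := by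
  rw [← pointLevels_padUnitLast_eq_self hN]
  exact pointLevels_padUnitLast_subset_passLevels N

/-! ### §3 · The `3 < τ < 4` slices from (U_N) and (Ko_N), statements about the single format `N = n²` -/

/-- **The wall cell from intrinsic data.**  At a cell `2n·n² ≤ m` the tower follows from (U_N) every even `e ≥ n` is a level of
`⟨n²⟩ ∈ ℂ^{n²} ⊗ ℂ^{n²} ⊗ ℂ^{n²}` and (Ko_N) the odd one of `n, n+1` is a non-empty level of the format `n²` — the landed
`tower_wall_of_unitLevels` with both hypotheses moved to the corner format. [this node] -/
theorem tower_wall_of_unitLevels_self (n : ℕ) (hm : 2 * n * (n * n) ≤ m)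
    (hU : ∀ e : ℕ, Even e → n ≤ e → e ∈ pointLevels (n * n) (unitTensor ℂ (n * n)))
    (hKo : ∃ o : ℕ, Odd o ∧ n ≤ o ∧ o ≤ n + 1 ∧ o ∉ emptyLevels (n * n) (n * n)) :
    ∀ k : ℕ, m < k * (n * n) → k ∈ passLevels m (n * n) ∪ emptyLevels m (n * n) := by
  rcases Nat.eq_zero_or_pos n with rfl | hn
  · intro k hk
    simp at hk
  have hN : n * n ≤ m := le_trans (Nat.le_mul_of_pos_left (n * n) (by omega : 0 < 2 * n)) hm
  obtain ⟨o, ho, hno, hon, hne⟩ := hKo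
  exact tower_wall_of_unitLevels n hm
    (fun e he hne' => by rw [pointLevels_padUnitLast_eq_self hN]; exact hU e he hne')
    ⟨o, ho, hno, hon, by rwa [mem_emptyLevels_iff_self hN]⟩

/-- **(U_N) is a finite check per `n`, intrinsic form** of the landed `unitLevels_of_prim`: the primitive even levels
`n ≤ e ≤ 2n` (`e < 2n` for even `n`) of `⟨n²⟩` generate all even levels `≥ n`. [this node] -/
theorem unitLevels_self_of_prim {n : ℕ} (hn : 0 < n)
    (h : ∀ e : ℕ, Even e → n ≤ e → e ≤ 2 * n → (Even n → e < 2 * n) →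
      e ∈ pointLevels (n * n) (unitTensor ℂ (n * n))) :
    ∀ e : ℕ, Even e → n ≤ e → e ∈ pointLevels (n * n) (unitTensor ℂ (n * n)) := by
  rw [← padUnitLast_self] at h ⊢
  exact unitLevels_of_prim hn h

end PointLevelFormat

end Summit.MatrixMultiplication.MatrixMultiplication.Theorems.ObstructionCalculus

/-! ### Tree-level corollaries for the item `InvariantSaturation` -/

namespace Summit.MatrixMultiplication.MatrixMultiplication.Theses.ObstructionDescent

open Summit.MatrixMultiplication.MatrixMultiplication.Theorems.ObstructionCalculus
open Literature.Computability.AlgebraicComplexity (unitTensor)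

/-- **THE `3 < τ < 4` SLICES OF `InvariantSaturation` FROM TWO STATEMENTS ABOUT ONE FORMAT.**  If, eventually in `n` and with
`N = n²`, (U_N) every even `e ≥ n` is a level of the unit tensor `⟨N⟩ ∈ ℂ^N ⊗ ℂ^N ⊗ ℂ^N` and (Ko_N) the odd one of `n, n+1` is a
non-empty level of the format `N`, then every slice `3 < τ < 4` of the item holds.  No ambient format, no (K0), no (P).
[this node] -/
theorem invariantSaturation_three_of_unitLevels_self
    (h : ∃ n₁ : ℕ, ∀ n : ℕ, n₁ ≤ n →
      (∀ e : ℕ, Even e → n ≤ e → e ∈ pointLevels (n * n) (unitTensor ℂ (n * n))) ∧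
      (∃ o : ℕ, Odd o ∧ n ≤ o ∧ o ≤ n + 1 ∧ o ∉ emptyLevels (n * n) (n * n))) :
    ∀ τ : ℝ, 3 < τ → τ < 4 → ∃ n₀ : ℕ, ∀ n m : ℕ, n₀ ≤ n → n * n ≤ m → (n : ℝ) ^ τ ≤ (m : ℝ) →
      ∀ k : ℕ, m < k * (n * n) → k ∈ passLevels m (n * n) ∪ emptyLevels m (n * n) := by
  obtain ⟨n₁, h⟩ := h
  exact invariantSaturation_three_of_wallCells
    ⟨n₁, fun n hn k hk => tower_wall_of_unitLevels_self n le_rfl (h n hn).1 (h n hn).2 k hk⟩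

/-- **… with (U_N) as the finite primitive check** (even `e`, `n ≤ e ≤ 2n`, `e < 2n` for even `n`). [this node] -/
theorem invariantSaturation_three_of_primLevels_self
    (h : ∃ n₁ : ℕ, ∀ n : ℕ, n₁ ≤ n →
      (∀ e : ℕ, Even e → n ≤ e → e ≤ 2 * n → (Even n → e < 2 * n) → e ∈ pointLevels (n * n) (unitTensor ℂ (n * n))) ∧
      (∃ o : ℕ, Odd o ∧ n ≤ o ∧ o ≤ n + 1 ∧ o ∉ emptyLevels (n * n) (n * n))) :
    ∀ τ : ℝ, 3 < τ → τ < 4 → ∃ n₀ : ℕ, ∀ n m : ℕ, n₀ ≤ n → n * n ≤ m → (n : ℝ) ^ τ ≤ (m : ℝ) →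
      ∀ k : ℕ, m < k * (n * n) → k ∈ passLevels m (n * n) ∪ emptyLevels m (n * n) := by
  obtain ⟨n₁, h⟩ := h
  refine invariantSaturation_three_of_unitLevels_self ⟨max n₁ 1, fun n hn => ⟨?_, (h n (le_trans (le_max_left _ _) hn)).2⟩⟩
  exact unitLevels_self_of_prim (lt_of_lt_of_le Nat.one_pos (le_trans (le_max_right _ _) hn))
    (h n (le_trans (le_max_left _ _) hn)).1

end Summit.MatrixMultiplication.MatrixMultiplication.Theses.ObstructionDescent

end
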